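import Mathlib.Analysis.Calculus.TaylorIntegral
import Mathlib.Analysis.Distribution.SchwartzSpace.Basic
import Mathlib.Analysis.SpecialFunctions.Pow.Real
import Literature.MathematicalPhysics.AQFT.OSAxiomsSchwinger
import HarnessLib

/-!
# Quantitative flatness of `⁰𝒮` test functions at the coincidence locus

`⁰𝒮(Eⁿ)` is the space of Schwartz `n`-point test functions vanishing WITH ALL DERIVATIVES at
coincident points (`IsOffDiagonal`, Osterwalder–Schrader 1973 §2; Kravchuk–Qiao–Rychkov 2021,
Remark 2.4).  The linear growth condition E0′ of Osterwalder–Schrader II (`HasLinearGrowth`: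
`|𝔖ₙ(F)| ≤ α (n!)^β |F|_{n s}` on `⁰𝒮`) is verified for lattice approximants by splitting the
lattice sum according to the distance to the diagonals; near a diagonal the only smallness
available is that of the test function.  This file provides that smallness QUANTITATIVELY, in
the currency of E0′ (`schwartzNorm`):

* `norm_le_of_iteratedFDeriv_eq_zero` — Taylor's theorem with vanishing Taylor polynomial: if
  `D^k f (x) = 0` for `k ≤ M` and `‖D^{M+1} f‖ ≤ C` on the segment `[x, x + y]`, then
  `‖f (x + y)‖ ≤ C ‖y‖^{M+1} / M!` (from Mathlib's integral-remainder formula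
  `map_add_eq_sum_add_integral_iteratedFDeriv`).
* `IsOffDiagonal.norm_le_of_mem_coincidenceLocus`, `IsOffDiagonal.norm_le_seminorm_mul_pow` —
  for `F ∈ ⁰𝒮` and ANY point `z` of the coincidence locus,
  `‖F y‖ ≤ ‖F‖_{0,M+1} ‖y − z‖^{M+1} / M!`; pair form `IsOffDiagonal.norm_le_seminorm_mul_pow_sub`
  (`z` = `y` with `y_b` replaced by `y_a`, so `‖y − z‖ = ‖y_b − y_a‖`).
* `IsOffDiagonal.one_add_norm_pow_mul_norm_le` — the weighted form used in E0′ counting: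
  for `‖y − z‖ ≤ 1`, `(1 + ‖y‖)^k ‖F y‖ ≤ 4^k |F|_m ‖y − z‖^{M+1} / M!` (`k, M+1 ≤ m`), i.e.
  flatness of order `M+1` at the diagonal AND Schwartz decay of order `k` at infinity from ONE
  Schwartz norm of finite order.
* `isClosed_coincidenceLocus`, `IsOffDiagonal.norm_le_seminorm_mul_infDist_pow` — the same with
  the distance `infDist y (coincidenceLocus n E)` to the locus (proper `E`, `2 ≤ n`).

All statements are for a general real normed space `E` (the tree's E4 case with the midpoint
configuration is `CurvatureKernelBound.Negative.FlatN.norm_le_flat`). [folklore]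
-/

open scoped SchwartzMap Nat
open Set MeasureTheory Metric

noncomputable section

namespace Literature.MathematicalPhysics.AQFT

/-! ### Taylor's theorem with vanishing Taylor polynomial -/

section Taylor

variable {E F : Type*} [NormedAddCommGroup E] [NormedSpace ℝ E] [NormedAddCommGroup F]
  [NormedSpace ℝ F] [CompleteSpace F]

/-- **Taylor flatness bound.** If `f` is `C^{M+1}` along the segment `[x, x + y]`, its
derivatives of orders `≤ M` vanish at `x`, and `‖D^{M+1} f‖ ≤ C` on the segment, then
`‖f (x + y)‖ ≤ C ‖y‖^{M+1} / M!` (Taylor's formula with integral remainder,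
`f (x + y) = (M!)⁻¹ ∫₀¹ (1 − t)^M D^{M+1} f (x + t y)(y, …, y) dt`, and `(1 − t)^M ≤ 1`). [folklore] -/
theorem norm_le_of_iteratedFDeriv_eq_zero {f : E → F} {x y : E} {M : ℕ} {C : ℝ}
    (hf : ∀ t ∈ Icc (0 : ℝ) 1, ContDiffAt ℝ (M + 1) f (x + t • y))
    (h0 : ∀ k ≤ M, iteratedFDeriv ℝ k f x = 0)
    (hC : ∀ t ∈ Icc (0 : ℝ) 1, ‖iteratedFDeriv ℝ (M + 1) f (x + t • y)‖ ≤ C) :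
    ‖f (x + y)‖ ≤ C * ‖y‖ ^ (M + 1) / M ! := by
  have key := map_add_eq_sum_add_integral_iteratedFDeriv (n := M) (x := x) (y := y)
    (fun t ht => hf t ht)
  have hsum : ∑ k ∈ Finset.range (M + 1),
      (k ! : ℝ)⁻¹ • (iteratedFDeriv ℝ k f x (fun _ => y)) = 0 := by
    refine Finset.sum_eq_zero fun k hk => ?_
    rw [h0 k (Nat.lt_succ_iff.mp (Finset.mem_range.mp hk))]
    simp
  rw [hsum, zero_add] at key
  have hint : ‖∫ t in (0 : ℝ)..1,
      (1 - t) ^ M • iteratedFDeriv ℝ (M + 1) f (x + t • y) (fun _ => y)‖ ≤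
        C * ‖y‖ ^ (M + 1) * |1 - 0| := by
    refine intervalIntegral.norm_integral_le_of_norm_le_const fun t ht => ?_
    rw [uIoc_of_le zero_le_one] at ht
    have ht' : t ∈ Icc (0 : ℝ) 1 := ⟨ht.1.le, ht.2⟩
    have h1 : (1 - t) ^ M ≤ 1 := pow_le_one₀ (by linarith [ht.2]) (by linarith [ht.1])
    have h2 : ‖iteratedFDeriv ℝ (M + 1) f (x + t • y) (fun _ => y)‖ ≤ C * ‖y‖ ^ (M + 1) :=
      ((iteratedFDeriv ℝ (M + 1) f (x + t • y)).le_opNorm_mul_pow_of_le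
        (pi_norm_const_le y)).trans
        (mul_le_mul_of_nonneg_right (hC t ht') (by positivity))
    rw [norm_smul, norm_pow, Real.norm_of_nonneg (by linarith [ht.2])]
    calc (1 - t) ^ M * ‖iteratedFDeriv ℝ (M + 1) f (x + t • y) (fun _ => y)‖
        ≤ 1 * (C * ‖y‖ ^ (M + 1)) := mul_le_mul h1 h2 (norm_nonneg _) zero_le_one
      _ = C * ‖y‖ ^ (M + 1) := one_mul _
  rw [sub_zero, abs_one, mul_one] at hint
  rw [key, norm_smul, norm_inv, Real.norm_natCast, div_eq_inv_mul]
  exact mul_le_mul_of_nonneg_left hint (by positivity)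

end Taylor

/-! ### Flatness of `⁰𝒮` functions at the coincidence locus -/

section OffDiagonal

variable {E : Type*} [NormedAddCommGroup E] [NormedSpace ℝ E] {n : ℕ}

/-- **`⁰𝒮` functions are flat at coincident points, quantitatively.** For `F ∈ ⁰𝒮(Eⁿ)`, any
point `z` of the coincidence locus, any `y` and any order `M`: if `‖D^{M+1} F‖ ≤ C` on the
segment `[z, y]` then `‖F y‖ ≤ C ‖y − z‖^{M+1} / M!` (Taylor at `z`, where the Taylor polynomial
of `F` vanishes identically; no support condition is involved). [folklore] -/
theorem IsOffDiagonal.norm_le_of_mem_coincidenceLocus {F : 𝓢((Fin n → E), ℂ)}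
    (hF : IsOffDiagonal F) {z : Fin n → E} (hz : z ∈ coincidenceLocus n E) (y : Fin n → E)
    (M : ℕ) {C : ℝ}
    (hC : ∀ t ∈ Icc (0 : ℝ) 1, ‖iteratedFDeriv ℝ (M + 1) F (z + t • (y - z))‖ ≤ C) :
    ‖F y‖ ≤ C * ‖y - z‖ ^ (M + 1) / M ! := by
  have h := norm_le_of_iteratedFDeriv_eq_zero (f := (F : (Fin n → E) → ℂ)) (x := z)
    (y := y - z) (M := M) (fun t _ => (F.smooth (M + 1)).contDiffAt) (fun k _ => hF z hz k) hC
  rwa [add_sub_cancel] at h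

/-- Global form: `‖F y‖ ≤ ‖F‖_{0,M+1} ‖y − z‖^{M+1} / M!` for `F ∈ ⁰𝒮`, `z` coincident, with
Mathlib's Schwartz seminorm `‖F‖_{0,M+1} = sup ‖D^{M+1} F‖`. [folklore] -/
theorem IsOffDiagonal.norm_le_seminorm_mul_pow {F : 𝓢((Fin n → E), ℂ)} (hF : IsOffDiagonal F)
    {z : Fin n → E} (hz : z ∈ coincidenceLocus n E) (y : Fin n → E) (M : ℕ) :
    ‖F y‖ ≤ SchwartzMap.seminorm ℂ 0 (M + 1) F * ‖y - z‖ ^ (M + 1) / M ! :=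
  hF.norm_le_of_mem_coincidenceLocus hz y M fun _ _ =>
    SchwartzMap.norm_iteratedFDeriv_le_seminorm ℂ F _ _

omit [NormedAddCommGroup E] [NormedSpace ℝ E] in
/-- Replacing the coordinate `y_b` by `y_a` (`a ≠ b`) lands on the coincidence locus. [folklore] -/
theorem update_mem_coincidenceLocus {a b : Fin n} (hab : a ≠ b) (y : Fin n → E) :
    Function.update y b (y a) ∈ coincidenceLocus n E :=
  ⟨a, b, hab, by simp [hab]⟩

omit [NormedSpace ℝ E] in
/-- … at sup-distance exactly `‖y_b − y_a‖` from `y`. [folklore] -/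
theorem norm_sub_update_eq (a b : Fin n) (y : Fin n → E) :
    ‖y - Function.update y b (y a)‖ = ‖y b - y a‖ := by
  have h : y - Function.update y b (y a) = Pi.single b (y b - y a) := by
    ext i
    by_cases hi : i = b
    · subst hi; simp
    · simp [hi]
  rw [h, Pi.norm_single]

/-- **Pair form.** For `F ∈ ⁰𝒮(Eⁿ)` and `a ≠ b`: `‖F y‖ ≤ ‖F‖_{0,M+1} ‖y_b − y_a‖^{M+1} / M!`
— an off-diagonal test function vanishes to every order in the separation of ANY two of its
arguments, uniformly in the others. [folklore] -/
theorem IsOffDiagonal.norm_le_seminorm_mul_pow_sub {F : 𝓢((Fin n → E), ℂ)}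
    (hF : IsOffDiagonal F) {a b : Fin n} (hab : a ≠ b) (y : Fin n → E) (M : ℕ) :
    ‖F y‖ ≤ SchwartzMap.seminorm ℂ 0 (M + 1) F * ‖y b - y a‖ ^ (M + 1) / M ! := by
  rw [← norm_sub_update_eq a b y]
  exact hF.norm_le_seminorm_mul_pow (update_mem_coincidenceLocus hab y) y M

/-- The finite sup of Schwartz seminorms of bi-order `≤ (k, l)` is dominated by the Schwartz
norm `|F|_m` of any order `m ≥ k, l` (the norm of E0′). [folklore] -/
theorem sup_seminorm_le_schwartzNorm {X : Type*} [NormedAddCommGroup X] [NormedSpace ℝ X]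
    {k l m : ℕ} (hk : k ≤ m) (hl : l ≤ m) (F : 𝓢(X, ℂ)) :
    (Finset.Iic (k, l)).sup (fun p : ℕ × ℕ => SchwartzMap.seminorm ℂ p.1 p.2) F ≤
      QuantumLattice.schwartzNorm m F := by
  have hfam : (fun p : ℕ × ℕ => SchwartzMap.seminorm ℂ p.1 p.2) = schwartzSeminormFamily ℂ X ℂ :=
    rfl
  rw [hfam]
  exact Seminorm.le_def.1 (Finset.sup_mono (Finset.Iic_subset_Iic.2 (Prod.mk_le_mk.2 ⟨hk, hl⟩))) F

/-- **Weighted flatness (the E0′ counting input).** For `F ∈ ⁰𝒮(Eⁿ)`, `z` coincident with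
`‖y − z‖ ≤ 1`, and orders `k, M + 1 ≤ m`:
`(1 + ‖y‖)^k ‖F y‖ ≤ 4^k |F|_m ‖y − z‖^{M+1} / M!` — flatness at the diagonal and Schwartz
decay at infinity simultaneously, from one Schwartz norm of finite order (along the segment
`w ∈ [z, y]` one has `1 + ‖y‖ ≤ 2 (1 + ‖w‖)` and `(1 + ‖w‖)^k ‖D^{M+1}F(w)‖ ≤ 2^k |F|_m`,
Mathlib `SchwartzMap.one_add_le_sup_seminorm_apply`). [folklore] -/
theorem IsOffDiagonal.one_add_norm_pow_mul_norm_le {F : 𝓢((Fin n → E), ℂ)}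
    (hF : IsOffDiagonal F) {z y : Fin n → E} (hz : z ∈ coincidenceLocus n E) (hyz : ‖y - z‖ ≤ 1)
    {k M m : ℕ} (hk : k ≤ m) (hM : M + 1 ≤ m) :
    (1 + ‖y‖) ^ k * ‖F y‖ ≤
      4 ^ k * QuantumLattice.schwartzNorm m F * ‖y - z‖ ^ (M + 1) / M ! := by
  set S := QuantumLattice.schwartzNorm m F with hS
  have hS0 : 0 ≤ S := QuantumLattice.schwartzNorm_nonneg m F
  have hy0 : 0 < (1 + ‖y‖) ^ k := by positivity
  -- bound on `D^{M+1} F` along the segment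
  have hC : ∀ t ∈ Icc (0 : ℝ) 1,
      ‖iteratedFDeriv ℝ (M + 1) F (z + t • (y - z))‖ ≤ 4 ^ k * S / (1 + ‖y‖) ^ k := by
    intro t ht
    set w := z + t • (y - z) with hw
    have h1 : (1 + ‖w‖) ^ k * ‖iteratedFDeriv ℝ (M + 1) F w‖ ≤ 2 ^ k * S := by
      refine (SchwartzMap.one_add_le_sup_seminorm_apply (𝕜 := ℂ) (m := (k, M + 1)) le_rfl le_rfl
        F w).trans ?_
      exact mul_le_mul_of_nonneg_left (sup_seminorm_le_schwartzNorm hk hM F) (by positivity)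
    have hyw : 1 + ‖y‖ ≤ 2 * (1 + ‖w‖) := by
      have : y = w + (1 - t) • (y - z) := by rw [hw]; module
      have hn : ‖y‖ ≤ ‖w‖ + 1 := by
        calc ‖y‖ = ‖w + (1 - t) • (y - z)‖ := by rw [← this]
          _ ≤ ‖w‖ + ‖(1 - t) • (y - z)‖ := norm_add_le _ _
          _ ≤ ‖w‖ + 1 := by
              rw [norm_smul, Real.norm_of_nonneg (by linarith [ht.2])]
              nlinarith [ht.1, ht.2, norm_nonneg (y - z)]
      linarith [norm_nonneg w]
    have hpow : (1 + ‖y‖) ^ k ≤ 2 ^ k * (1 + ‖w‖) ^ k := by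
      rw [← mul_pow]; exact pow_le_pow_left₀ (by positivity) hyw k
    have hw0 : 0 < (1 + ‖w‖) ^ k := by positivity
    rw [le_div_iff₀ hy0]
    calc ‖iteratedFDeriv ℝ (M + 1) F w‖ * (1 + ‖y‖) ^ k
        ≤ ‖iteratedFDeriv ℝ (M + 1) F w‖ * (2 ^ k * (1 + ‖w‖) ^ k) :=
          mul_le_mul_of_nonneg_left hpow (norm_nonneg _)
      _ = 2 ^ k * ((1 + ‖w‖) ^ k * ‖iteratedFDeriv ℝ (M + 1) F w‖) := by ring
      _ ≤ 2 ^ k * (2 ^ k * S) := mul_le_mul_of_nonneg_left h1 (by positivity)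
      _ = 4 ^ k * S := by
          rw [← mul_assoc, ← mul_pow]; norm_num
  have h := hF.norm_le_of_mem_coincidenceLocus hz y M hC
  rw [mul_comm, ← le_div_iff₀ hy0]
  calc ‖F y‖ ≤ 4 ^ k * S / (1 + ‖y‖) ^ k * ‖y - z‖ ^ (M + 1) / M ! := h
    _ = 4 ^ k * S * ‖y - z‖ ^ (M + 1) / M ! / (1 + ‖y‖) ^ k := by ring

/-- Pair form of the weighted flatness bound: for `a ≠ b` with `‖y_b − y_a‖ ≤ 1` and
`k, M + 1 ≤ m`, `(1 + ‖y‖)^k ‖F y‖ ≤ 4^k |F|_m ‖y_b − y_a‖^{M+1} / M!`. [folklore] -/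
theorem IsOffDiagonal.one_add_norm_pow_mul_norm_le_sub {F : 𝓢((Fin n → E), ℂ)}
    (hF : IsOffDiagonal F) {a b : Fin n} (hab : a ≠ b) {y : Fin n → E} (hy : ‖y b - y a‖ ≤ 1)
    {k M m : ℕ} (hk : k ≤ m) (hM : M + 1 ≤ m) :
    (1 + ‖y‖) ^ k * ‖F y‖ ≤
      4 ^ k * QuantumLattice.schwartzNorm m F * ‖y b - y a‖ ^ (M + 1) / M ! := by
  rw [← norm_sub_update_eq a b y] at hy ⊢
  exact hF.one_add_norm_pow_mul_norm_le (update_mem_coincidenceLocus hab y) hy hk hM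

/-! ### Distance to the coincidence locus -/

/-- The coincidence locus is closed (a finite union of closed "partial diagonals"
`{x | x_i = x_j}`). [folklore] -/
theorem isClosed_coincidenceLocus (n : ℕ) (E : Type*) [TopologicalSpace E] [T2Space E] :
    IsClosed (coincidenceLocus n E) := by
  have h : coincidenceLocus n E = ⋃ i : Fin n, ⋃ j : Fin n, ⋃ (_ : i ≠ j), {x | x i = x j} := by
    ext x; simp [coincidenceLocus]
  rw [h]
  refine isClosed_iUnion_of_finite fun i => isClosed_iUnion_of_finite fun j =>
    isClosed_iUnion_of_finite fun _ => ?_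
  exact isClosed_eq (continuous_apply i) (continuous_apply j)

/-- For `2 ≤ n` the coincidence locus is nonempty (constant configurations). [folklore] -/
theorem coincidenceLocus_nonempty {n : ℕ} (hn : 2 ≤ n) (E : Type*) [Nonempty E] :
    (coincidenceLocus n E).Nonempty := by
  obtain ⟨e⟩ := ‹Nonempty E›
  refine ⟨fun _ => e, ⟨0, by omega⟩, ⟨1, by omega⟩, ?_, rfl⟩
  simp [Fin.ext_iff]

/-- **Flatness in the distance to the locus.** On a proper space (`E` finite-dimensional) and
for `2 ≤ n`: `‖F y‖ ≤ ‖F‖_{0,M+1} · dist(y, coincidence locus)^{M+1} / M!` for every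
`F ∈ ⁰𝒮(Eⁿ)` (the infimum distance is attained on the closed nonempty locus). [folklore] -/
theorem IsOffDiagonal.norm_le_seminorm_mul_infDist_pow [ProperSpace E] (hn : 2 ≤ n)
    {F : 𝓢((Fin n → E), ℂ)} (hF : IsOffDiagonal F) (y : Fin n → E) (M : ℕ) :
    ‖F y‖ ≤ SchwartzMap.seminorm ℂ 0 (M + 1) F *
      infDist y (coincidenceLocus n E) ^ (M + 1) / M ! := by
  haveI : Nonempty E := ⟨y ⟨0, by omega⟩⟩
  obtain ⟨z, hz, hdist⟩ := (isClosed_coincidenceLocus n E).exists_infDist_eq_dist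
    (coincidenceLocus_nonempty hn E) y
  rw [hdist, dist_eq_norm]
  exact hF.norm_le_seminorm_mul_pow hz y M

end OffDiagonal

end Literature.MathematicalPhysics.AQFT

end
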